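import Summits.RiemannHypothesis.RiemannHypothesis.Theorems.Splittings.LiTuranLawRH
import Summits.RiemannHypothesis.RiemannHypothesis.Theorems.Splittings.LiTuranTrigWindow
import HarnessLib

/-!
# The TURÁN (LOG-CONCAVITY) LAW for the Keiper–Li coefficients: the `¬RH` branch, the UNCONDITIONAL law, the one-pair layer (SketchG10 §§5–6)

Cell rh-split, seat rh-split-li-bridge g10 (brief sha16 f79c5f09d8bcb036), card `run/shared/lean/pub/rh-split/cards/SPLIT-li-bridge.md` §17;
kernel source `HOME/rh-split-li-bridge/SketchG10.lean` sha16 38c6e923d0f0bc96 (759 l, farm rc 0 · 0 err · 0 warn, std axioms), cut by the seat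
at the scratch's section boundaries (§§1–3 / §4 / §§5–6), decl text byte-verbatim; deltas = namespace `RhSplit.LiBridgeG10` ↦
`…Theorems.Splittings.LiTuranLaw`, imports, module docstrings.
Tree inputs only (cited, not re-derived): `LiExtremalLayer.layer_law` (under `¬RH`: `r₀ⁿλ_n + h(n) → 0` for the extremal layer's
positive-weight trigonometric sum `h`, radius `0 < r₀ < 1`), `LiExtremalLayer.rotate_ne_one` (`r(1 − 1/ρ)⁻¹ ≠ 1` for real `r`),
`FordL33.order_pos`, the window file's `trigSum` / `mass` / `varConst` / `abs_trigSum_le`, this chain's `turanHold_syndetic_of_rh`,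
`turanFail_io_of_rh` (`LiTuranLawRH`) and `sum_turanTrig_ge` (`LiTuranTrigWindow`).  Standard axioms.  Zero definitions.
`λ_n = keiperLiCoeff n`, `T_{n+1} := λ_{n+1}² − λ_nλ_{n+2}`.

* `¬RH` ⟹ `T_{n+1} > 0` on a SYNDETIC set (`turanHold_syndetic_of_not_rh`, §5): `r₀^{2n+2}T_{n+1} = D(n) + o(1)` with
  `D(n) = h(n+1)² − h(n)h(n+2)`, and the window mean of `D` is `≥ μ/2·` margin by `sum_turanTrig_ge`, `μ = Σ m_ρ²(1 − Re u_ρ²) > 0`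
  because no rotation `u_ρ = r₀(1 − 1/ρ)⁻¹` is `±1`.
* Hence UNCONDITIONALLY (with the RH branch `turanHold_syndetic_of_rh`): `λ_nλ_{n+2} < λ_{n+1}²` on a syndetic set of indices
  (`turanHold_syndetic`), infinitely often (`turanHold_io`), and the Li sequence is NEVER eventually log-convex (`not_eventually_logConvex`).
* `¬RH` with a ONE-PAIR EXTREMAL LAYER (every non-trivial zero minimising `‖1 − 1/ρ‖` is `ρ₀` or `ρ̄₀`) ⟹ `T_{n+1} > 0` EVENTUALLY
  (`eventually_logConcave_of_not_rh_of_pairLayer`, §6): all rotations of the layer are `u₁` or `ū₁`, `h(k) = c·Re(u₁ᵏ)` with `c > 0`, and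
  the trigonometric Turán identity `Re(u^{n+1})² − Re(uⁿ)Re(u^{n+2}) = (Im u)²‖uⁿ‖²` makes `r₀^{2n+2}T_{n+1} → c²(Im u₁)² > 0`.
  So `TuranFail := «T_{n+1} < 0 i.o.»` — an RH-CONSEQUENCE by `turanFail_io_of_rh` — has a converse exactly up to the alternative
  «`¬RH` with ≥ 2 conjugate pairs on the extremal layer» (where `T` can take both signs; card §17.2): the γ-type splitting
  `rh_of_pairLayerAlt_of_turanFail : (¬RH → one-pair layer) → TuranFail → RH` and `turanFail_iff_rh_of_pairLayerAlt`
  (CONDITIONAL bookkeeping relative to the unproved, RH-vacuous layer alternative `A′`; NOT a bridge, NOT an RH-equivalence).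

HONEST LABEL: «SPLITTING SEARCH over kernel-typed RH-EQUIVALENCES; a splitting A ∧ B ⟹ RH is CONDITIONAL bookkeeping unless A and B are
both proved; nothing here bears on the truth of RH.»  Every theorem below is an RH-FREE implication from `¬RiemannHypothesis` (plus, in §6, a stated layer hypothesis), an
UNCONDITIONAL theorem (`turanHold_syndetic`, `turanHold_io`, `not_eventually_logConvex`), or CONDITIONAL bookkeeping (§6, last two);
none is an RH-equivalence and none is claimed to be; certifies nothing about RH.
-/

set_option linter.dupNamespace false

noncomputable section

open Filter Topology Asymptotics
open scoped ComplexConjugate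

namespace Summit.RiemannHypothesis.RiemannHypothesis.Theorems.Splittings.LiTuranLaw

open Literature.NumberTheory.LFunctions
open Summit.RiemannHypothesis.RiemannHypothesis.Theorems.Splittings
open Summit.RiemannHypothesis.RiemannHypothesis.Theorems.Splittings.LiExtremalLayer

/-! ## §5 The `¬RH` branch: `λ_n λ_{n+2} < λ_{n+1}²` on a syndetic set — hence UNCONDITIONALLY (with §2)

Under `¬RH`, `r₀^{2n+2} T_{n+1} = D(n) + o(1)` with `D(n) = h(n+1)² − h(n)h(n+2)` for the layer's positive-weight trigonometric sum `h`
(tree `LiExtremalLayer.layer_law`); §4 gives `Σ_{window} D ≥ (L/2)μ − 2C₂` with `μ = Σ m_ρ²(1 − Re u_ρ²) > 0` (`u_ρ ≠ ±1` by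
`rotate_ne_one`), so `D ≥ 1/L` somewhere in every window of length `L`, and `T_{n+1} > 0` there. -/

/-- `|p q| ≤ P Q` from `|p| ≤ P`, `|q| ≤ Q`. -/
private theorem abs_mul_le_of_abs_le {p q P Q : ℝ} (hp : |p| ≤ P) (hq : |q| ≤ Q) : |p * q| ≤ P * Q := by
  rw [abs_mul]
  exact mul_le_mul hp hq (abs_nonneg _) ((abs_nonneg _).trans hp)


/-- **`¬RH` ⟹ `λ_n λ_{n+2} < λ_{n+1}²` on a syndetic set** (window-mean argument on the extremal layer). RH-FREE implication. -/
theorem turanHold_syndetic_of_not_rh (hRH : ¬ _root_.RiemannHypothesis) :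
    ∃ L n₀ : ℕ, ∀ N : ℕ, n₀ ≤ N →
      ∃ n ∈ Finset.Ico N (N + L), keiperLiCoeff n * keiperLiCoeff (n + 2) < keiperLiCoeff (n + 1) ^ 2 := by
  classical
  obtain ⟨r₀, hr₀0, hr₀1, E, hE, hEmem, hglob, hlim⟩ := layer_law hRH
  set m : ℂ → ℝ := fun ρ ↦ (riemannZetaZeroOrder ρ : ℝ) with hm
  set u : ℂ → ℂ := fun ρ ↦ (r₀ : ℂ) * (1 - 1 / ρ)⁻¹ with hu
  have hmpos : ∀ ρ ∈ E, 0 < m ρ := fun ρ hρ ↦ by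
    simp only [hm]; exact_mod_cast FordL33.order_pos ⟨ρ, (hEmem ρ hρ).1⟩
  have hm' : ∀ ρ ∈ E, 0 ≤ m ρ := fun ρ hρ ↦ (hmpos ρ hρ).le
  have hunit : ∀ ρ ∈ E, ‖u ρ‖ = 1 := by
    intro ρ hρ
    simp only [hu, norm_mul, Complex.norm_real, Real.norm_eq_abs, abs_of_pos hr₀0, norm_inv,
      (hEmem ρ hρ).2]
    exact mul_inv_cancel₀ hr₀0.ne'
  have hne1 : ∀ ρ ∈ E, u ρ ≠ 1 := fun ρ hρ ↦ rotate_ne_one (hEmem ρ hρ).1 r₀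
  have hne1' : ∀ ρ ∈ E, u ρ ≠ -1 := by
    intro ρ hρ h
    apply rotate_ne_one (hEmem ρ hρ).1 (-r₀)
    rw [Complex.ofReal_neg, neg_mul]
    simp only [hu] at h
    rw [h, neg_neg]
  -- `Re(u_ρ²) < 1` for each rotation (`u_ρ² ≠ 1` on the unit circle)
  have hre_lt : ∀ ρ ∈ E, (u ρ ^ 2).re < 1 := by
    intro ρ hρ
    have hn2 : ‖u ρ ^ 2‖ = 1 := by rw [norm_pow, hunit ρ hρ, one_pow]
    have hle : (u ρ ^ 2).re ≤ 1 := (Complex.re_le_norm _).trans hn2.le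
    refine lt_of_le_of_ne hle fun heq ↦ ?_
    have hsq1 : u ρ ^ 2 = 1 := by
      have hnormSq : Complex.normSq (u ρ ^ 2) = 1 := by rw [Complex.normSq_eq_norm_sq, hn2, one_pow]
      rw [Complex.normSq_apply, heq, mul_one] at hnormSq
      have him : (u ρ ^ 2).im = 0 := by nlinarith
      exact Complex.ext (by simp [heq]) (by simp [him])
    have hfac : (u ρ - 1) * (u ρ + 1) = 0 := by
      have : (u ρ - 1) * (u ρ + 1) = u ρ ^ 2 - 1 := by ring
      rw [this, hsq1, sub_self]
    rcases mul_eq_zero.1 hfac with h | h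
    · exact hne1 ρ hρ (sub_eq_zero.1 h)
    · exact hne1' ρ hρ (add_eq_zero_iff_eq_neg.1 h)
  set μ : ℝ := ∑ ρ ∈ E, m ρ ^ 2 * (1 - (u ρ ^ 2).re) with hμ
  have hμpos : 0 < μ :=
    Finset.sum_pos (fun ρ hρ ↦ mul_pos (pow_pos (hmpos ρ hρ) 2) (by linarith [hre_lt ρ hρ])) hE
  -- window length and the per-window good index
  set L : ℕ := ⌈2 * (2 * varConst E m u + 1) / μ⌉₊ + 1 with hLdef
  have hLpos : 0 < L := Nat.succ_pos _
  have hLμ : 2 * varConst E m u + 1 ≤ (L : ℝ) / 2 * μ := by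
    have h1 : 2 * (2 * varConst E m u + 1) / μ ≤ (L : ℝ) := by
      rw [hLdef]; push_cast; exact (Nat.le_ceil _).trans (le_add_of_nonneg_right zero_le_one)
    rw [div_le_iff₀ hμpos] at h1
    linarith
  have hgood : ∀ N : ℕ, ∃ n ∈ Finset.Ico N (N + L),
      1 / (L : ℝ) ≤ trigSum E m u (n + 1) ^ 2 - trigSum E m u n * trigSum E m u (n + 2) := by
    intro N
    have hsum := sum_turanTrig_ge hm' hunit N L
    have hne : (Finset.Ico N (N + L)).Nonempty := ⟨N, Finset.mem_Ico.2 ⟨le_rfl, by omega⟩⟩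
    refine Finset.exists_le_of_sum_le hne ?_
    rw [Finset.sum_const, Nat.card_Ico, Nat.add_sub_cancel_left, nsmul_eq_mul,
      mul_one_div_cancel (by positivity)]
    linarith
  -- the error tolerance
  have hM : 0 < mass E m := Finset.sum_pos hmpos hE
  have habs : ∀ n, |trigSum E m u n| ≤ mass E m := fun n ↦ abs_trigSum_le hm' hunit n
  set δ : ℝ := min 1 (1 / (L : ℝ) / (2 * (4 * mass E m + 1))) with hδ
  have hδpos : 0 < δ := lt_min one_pos (by positivity)
  have hδ1 : δ ≤ 1 := min_le_left _ _
  have hδ2 : (4 * mass E m + 1) * δ ≤ 1 / (L : ℝ) / 2 := by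
    have h' := mul_le_mul_of_nonneg_left (min_le_right 1 (1 / (L : ℝ) / (2 * (4 * mass E m + 1))))
      (show 0 ≤ 4 * mass E m + 1 by positivity)
    calc (4 * mass E m + 1) * δ ≤ (4 * mass E m + 1) * (1 / (L : ℝ) / (2 * (4 * mass E m + 1))) := h'
      _ = 1 / (L : ℝ) / 2 := by field_simp
  obtain ⟨n₀, hn₀⟩ := Metric.tendsto_atTop.1 hlim δ hδpos
  have hf : ∀ k : ℕ, n₀ ≤ k → |r₀ ^ k * keiperLiCoeff k + trigSum E m u k| ≤ δ := fun k hk ↦ by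
    have := hn₀ k hk
    rw [Real.dist_0_eq_abs] at this
    exact this.le
  refine ⟨L, n₀, fun N hN ↦ ?_⟩
  obtain ⟨n, hnI, hD⟩ := hgood N
  refine ⟨n, hnI, ?_⟩
  have hn : n₀ ≤ n := hN.trans (Finset.mem_Ico.1 hnI).1
  obtain ⟨f₀, hf₀⟩ : ∃ f : ℝ, f = r₀ ^ n * keiperLiCoeff n + trigSum E m u n := ⟨_, rfl⟩
  obtain ⟨f₁, hf₁⟩ : ∃ f : ℝ, f = r₀ ^ (n + 1) * keiperLiCoeff (n + 1) + trigSum E m u (n + 1) := ⟨_, rfl⟩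
  obtain ⟨f₂, hf₂⟩ : ∃ f : ℝ, f = r₀ ^ (n + 2) * keiperLiCoeff (n + 2) + trigSum E m u (n + 2) := ⟨_, rfl⟩
  have a₀ : |f₀| ≤ δ := hf₀ ▸ hf n hn
  have a₁ : |f₁| ≤ δ := hf₁ ▸ hf (n + 1) (by omega)
  have a₂ : |f₂| ≤ δ := hf₂ ▸ hf (n + 2) (by omega)
  have q₁ := (abs_le.1 (abs_mul_le_of_abs_le a₁ (habs (n + 1)))).2
  have q₀ := (abs_le.1 (abs_mul_le_of_abs_le a₀ (habs (n + 2)))).1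
  have q₂ := (abs_le.1 (abs_mul_le_of_abs_le a₂ (habs n))).1
  have q₃ := (abs_le.1 (abs_mul_le_of_abs_le a₀ a₂)).2
  have hδδ : δ * δ ≤ δ := by nlinarith
  have hY : 0 < (f₁ - trigSum E m u (n + 1)) ^ 2 - (f₀ - trigSum E m u n) * (f₂ - trigSum E m u (n + 2)) := by
    have hL1 : 0 < 1 / (L : ℝ) := by positivity
    nlinarith [sq_nonneg f₁, hD, q₁, q₀, q₂, q₃, hδδ, hδ2]
  have hscale : r₀ ^ n * r₀ ^ (n + 2) * (keiperLiCoeff (n + 1) ^ 2 - keiperLiCoeff n * keiperLiCoeff (n + 2))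
      = (f₁ - trigSum E m u (n + 1)) ^ 2 - (f₀ - trigSum E m u n) * (f₂ - trigSum E m u (n + 2)) := by
    rw [hf₀, hf₁, hf₂]
    ring
  have hpos := pos_of_mul_pos_right (hscale ▸ hY) (by positivity)
  linarith

/-- **UNCONDITIONAL: the Li sequence is strictly log-concave (`λ_n λ_{n+2} < λ_{n+1}²`) on a syndetic set of indices**
(RH: §2; `¬RH`: the window-mean theorem above). UNCONDITIONAL THEOREM. -/
theorem turanHold_syndetic : ∃ L n₀ : ℕ, ∀ N : ℕ, n₀ ≤ N →
    ∃ n ∈ Finset.Ico N (N + L), keiperLiCoeff n * keiperLiCoeff (n + 2) < keiperLiCoeff (n + 1) ^ 2 := by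
  by_cases hRH : _root_.RiemannHypothesis
  · exact turanHold_syndetic_of_rh hRH
  · exact turanHold_syndetic_of_not_rh hRH

/-- **UNCONDITIONAL: `λ_n λ_{n+2} < λ_{n+1}²` for infinitely many `n`.** -/
theorem turanHold_io (N : ℕ) :
    ∃ n : ℕ, N ≤ n ∧ keiperLiCoeff n * keiperLiCoeff (n + 2) < keiperLiCoeff (n + 1) ^ 2 := by
  obtain ⟨L, n₀, h⟩ := turanHold_syndetic
  obtain ⟨n, hn, hlt⟩ := h (max N n₀) (le_max_right _ _)
  exact ⟨n, (le_max_left _ _).trans (Finset.mem_Ico.1 hn).1, hlt⟩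

/-- **The Li sequence is never eventually log-convex** (unconditional form of `not_rh_of_eventually_logConvex`). -/
theorem not_eventually_logConvex :
    ¬ ∃ N : ℕ, ∀ n : ℕ, N ≤ n → keiperLiCoeff (n + 1) ^ 2 ≤ keiperLiCoeff n * keiperLiCoeff (n + 2) := by
  rintro ⟨N, hN⟩
  obtain ⟨n, hn, hlt⟩ := turanHold_io N
  exact absurd (hN n hn) (not_le.2 hlt)

/-! ## §6 `¬RH` with a ONE-PAIR extremal layer ⟹ the Li sequence IS eventually log-concave

Under `¬RH` the Li sequence lives at the scale `r₀^{-n}` of the EXTREMAL LAYER (tree `LiExtremalLayer.layer_law`: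
`r₀ⁿλ_n + Σ_{ρ∈E} m(ρ) Re(u_ρⁿ) → 0`, `u_ρ = r₀(1 − 1/ρ)⁻¹`, `‖u_ρ‖ = 1`).  If the modulus-minimising zeros form (a subset of)
ONE conjugate pair `{ρ₀, ρ̄₀}`, the sum is a single cosine `c·Re(u₁ⁿ)` (`c > 0`, `u₁ ≠ ±1`) and the trigonometric Turán identity
`Re(u^{n+1})² − Re(uⁿ)Re(u^{n+2}) = (Im u)²·‖uⁿ‖²` (`re_turan_identity`) gives `r₀^{2n+2} T_{n+1} → c²(Im u₁)² > 0`: EVENTUAL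
LOG-CONCAVITY.  So the converse of §3 (`TuranFail ⟹ RH`) holds exactly up to the alternative «`¬RH` with an extremal layer meeting
at least two conjugate pairs» (where `T` can take both signs: card §17.2 numerics) — the γ-type splitting
`rh_of_pairLayerAlt_of_turanFail` below; CONDITIONAL bookkeeping, not a bridge. -/

/-- The trigonometric Turán identity in coordinates: `Re(w u)² − Re(w)·Re(w u²) = (Im u)²·(Re w² + Im w²)`. -/
private theorem re_turan_identity (u w : ℂ) :
    (w * u).re ^ 2 - w.re * (w * u ^ 2).re = u.im ^ 2 * (w.re ^ 2 + w.im ^ 2) := by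
  simp only [Complex.mul_re, Complex.mul_im, pow_two]
  ring

/-- **`¬RH` + ONE-PAIR EXTREMAL LAYER ⟹ eventually `λ_n λ_{n+2} < λ_{n+1}²`.**  Hypothesis `hpair`: every non-trivial zero
minimising `‖1 − 1/ρ‖` is `ρ₀` or `ρ̄₀` (under `¬RH` the minimum `r₀ < 1` is attained on a finite layer; under RH every zero
minimises, so `hpair` is then false and the theorem is about the `¬RH` world only).  RH-FREE implication. -/
theorem eventually_logConcave_of_not_rh_of_pairLayer (hRH : ¬ _root_.RiemannHypothesis)
    (hpair : ∃ ρ₀ : ℂ, ∀ ρ ∈ ZetaZeros.riemannZetaNontrivialZeros,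
      (∀ ρ' ∈ ZetaZeros.riemannZetaNontrivialZeros, ‖1 - 1 / ρ‖ ≤ ‖1 - 1 / ρ'‖) → ρ = ρ₀ ∨ ρ = conj ρ₀) :
    ∃ N : ℕ, ∀ n : ℕ, N ≤ n → keiperLiCoeff n * keiperLiCoeff (n + 2) < keiperLiCoeff (n + 1) ^ 2 := by
  obtain ⟨r₀, hr₀0, hr₀1, E, hE, hEmem, hglob, hlim⟩ := layer_law hRH
  obtain ⟨ρ₀, hρ₀⟩ := hpair
  obtain ⟨ρ₁, hρ₁E⟩ := hE
  have hmin : ∀ ρ ∈ E, ∀ ρ' ∈ ZetaZeros.riemannZetaNontrivialZeros, ‖1 - 1 / ρ‖ ≤ ‖1 - 1 / ρ'‖ := by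
    intro ρ hρ ρ' hρ'
    rw [(hEmem ρ hρ).2]
    exact hglob ρ' hρ'
  have hcases : ∀ ρ ∈ E, ρ = ρ₀ ∨ ρ = conj ρ₀ := fun ρ hρ ↦ hρ₀ ρ (hEmem ρ hρ).1 (hmin ρ hρ)
  set u₁ : ℂ := (r₀ : ℂ) * (1 - 1 / ρ₁)⁻¹ with hu₁
  have hconj : ∀ ρ : ℂ, (r₀ : ℂ) * (1 - 1 / conj ρ)⁻¹ = conj ((r₀ : ℂ) * (1 - 1 / ρ)⁻¹) := by
    intro ρ
    simp [map_mul, map_inv₀, map_sub, map_one, Complex.conj_ofReal]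
  -- every rotation of the layer is `u₁` or its conjugate, so all have the same real parts of powers
  have hu : ∀ ρ ∈ E, (r₀ : ℂ) * (1 - 1 / ρ)⁻¹ = u₁ ∨ (r₀ : ℂ) * (1 - 1 / ρ)⁻¹ = conj u₁ := by
    intro ρ hρ
    rcases hcases ρ hρ with h | h <;> rcases hcases ρ₁ hρ₁E with h₁ | h₁
    · left; rw [hu₁, h, h₁]
    · right; rw [hu₁, h, h₁, hconj, Complex.conj_conj]
    · right; rw [hu₁, h, h₁, hconj]
    · left; rw [hu₁, h, h₁]
  have hre : ∀ ρ ∈ E, ∀ k : ℕ, (((r₀ : ℂ) * (1 - 1 / ρ)⁻¹) ^ k).re = (u₁ ^ k).re := by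
    intro ρ hρ k
    rcases hu ρ hρ with h | h
    · rw [h]
    · rw [h, ← map_pow, Complex.conj_re]
  -- the trigonometric sum of the layer law is a single cosine `c · Re(u₁^k)`, `c > 0`
  set c : ℝ := ∑ ρ ∈ E, (riemannZetaZeroOrder ρ : ℝ) with hc
  have hcpos : 0 < c :=
    Finset.sum_pos (fun ρ hρ ↦ by exact_mod_cast FordL33.order_pos ⟨ρ, (hEmem ρ hρ).1⟩) ⟨ρ₁, hρ₁E⟩
  have htrig : ∀ k : ℕ, trigSum E (fun ρ ↦ (riemannZetaZeroOrder ρ : ℝ)) (fun ρ ↦ (r₀ : ℂ) * (1 - 1 / ρ)⁻¹) k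
      = c * (u₁ ^ k).re := by
    intro k
    simp only [trigSum]
    rw [hc, Finset.sum_mul]
    exact Finset.sum_congr rfl fun ρ hρ ↦ by rw [hre ρ hρ k]
  have hlim' : Tendsto (fun k : ℕ ↦ r₀ ^ k * keiperLiCoeff k + c * (u₁ ^ k).re) atTop (𝓝 0) :=
    hlim.congr fun k ↦ by rw [htrig]
  -- unit modulus, non-real rotation
  have hunit : ‖u₁‖ = 1 := by
    rw [hu₁, norm_mul, Complex.norm_real, Real.norm_eq_abs, abs_of_pos hr₀0, norm_inv, (hEmem ρ₁ hρ₁E).2]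
    exact mul_inv_cancel₀ hr₀0.ne'
  have hne1 : u₁ ≠ 1 := rotate_ne_one (hEmem ρ₁ hρ₁E).1 r₀
  have hne1' : u₁ ≠ -1 := by
    intro h
    apply rotate_ne_one (hEmem ρ₁ hρ₁E).1 (-r₀)
    rw [Complex.ofReal_neg, neg_mul, ← hu₁, h, neg_neg]
  have him : u₁.im ≠ 0 := by
    intro h0
    have hn : Complex.normSq u₁ = 1 := by rw [Complex.normSq_eq_norm_sq, hunit, one_pow]
    rw [Complex.normSq_apply, h0, mul_zero, add_zero] at hn
    rcases mul_self_eq_one_iff.1 hn with h1 | h1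
    · exact hne1 (Complex.ext (by simp [h1]) (by simp [h0]))
    · exact hne1' (Complex.ext (by simp [h1]) (by simp [h0]))
  have hR : ∀ k : ℕ, |(u₁ ^ k).re| ≤ 1 := fun k ↦
    (Complex.abs_re_le_norm _).trans (by rw [norm_pow, hunit, one_pow])
  have hRI : ∀ k : ℕ, (u₁ ^ k).re ^ 2 + (u₁ ^ k).im ^ 2 = 1 := fun k ↦ by
    have h := Complex.normSq_apply (u₁ ^ k)
    rw [Complex.normSq_eq_norm_sq, norm_pow, hunit, one_pow] at h
    nlinarith [h]
  -- tolerance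
  set b : ℝ := u₁.im with hb
  have hb2 : 0 < b ^ 2 := lt_of_le_of_ne (sq_nonneg b) (Ne.symm (pow_ne_zero 2 him))
  have hcb : 0 < c ^ 2 * b ^ 2 := mul_pos (pow_pos hcpos 2) hb2
  set δ : ℝ := min 1 (c ^ 2 * b ^ 2 / (2 * (4 * c + 2))) with hδ
  have hδpos : 0 < δ := lt_min one_pos (by positivity)
  have hδ1 : δ ≤ 1 := min_le_left _ _
  have hδ2 : (4 * c + 2) * δ ≤ c ^ 2 * b ^ 2 / 2 := by
    have h' := mul_le_mul_of_nonneg_left (min_le_right 1 (c ^ 2 * b ^ 2 / (2 * (4 * c + 2))))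
      (show 0 ≤ 4 * c + 2 by positivity)
    calc (4 * c + 2) * δ ≤ (4 * c + 2) * (c ^ 2 * b ^ 2 / (2 * (4 * c + 2))) := h'
      _ = c ^ 2 * b ^ 2 / 2 := by field_simp
  obtain ⟨N, hN⟩ := Metric.tendsto_atTop.1 hlim' δ hδpos
  have hf : ∀ k : ℕ, N ≤ k → |r₀ ^ k * keiperLiCoeff k + c * (u₁ ^ k).re| ≤ δ := fun k hk ↦ by
    have := hN k hk
    rw [Real.dist_0_eq_abs] at this
    exact this.le
  refine ⟨N, fun n hn ↦ ?_⟩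
  obtain ⟨f₀, hf₀⟩ : ∃ f : ℝ, f = r₀ ^ n * keiperLiCoeff n + c * (u₁ ^ n).re := ⟨_, rfl⟩
  obtain ⟨f₁, hf₁⟩ : ∃ f : ℝ, f = r₀ ^ (n + 1) * keiperLiCoeff (n + 1) + c * (u₁ ^ (n + 1)).re := ⟨_, rfl⟩
  obtain ⟨f₂, hf₂⟩ : ∃ f : ℝ, f = r₀ ^ (n + 2) * keiperLiCoeff (n + 2) + c * (u₁ ^ (n + 2)).re := ⟨_, rfl⟩
  have a₀ : |f₀| ≤ δ := hf₀ ▸ hf n hn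
  have a₁ : |f₁| ≤ δ := hf₁ ▸ hf (n + 1) (by omega)
  have a₂ : |f₂| ≤ δ := hf₂ ▸ hf (n + 2) (by omega)
  -- the main term
  have main : (u₁ ^ (n + 1)).re ^ 2 - (u₁ ^ n).re * (u₁ ^ (n + 2)).re = b ^ 2 := by
    have h := re_turan_identity u₁ (u₁ ^ n)
    rw [← pow_succ, ← pow_add, hRI n, mul_one] at h
    exact h
  -- the error terms
  have q₁ := (abs_le.1 (abs_mul_le_of_abs_le a₁ (hR (n + 1)))).2
  have q₀ := (abs_le.1 (abs_mul_le_of_abs_le a₀ (hR (n + 2)))).1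
  have q₂ := (abs_le.1 (abs_mul_le_of_abs_le a₂ (hR n))).1
  have q₃ := (abs_le.1 (abs_mul_le_of_abs_le a₀ a₂)).2
  have hδδ : δ * δ ≤ δ := by nlinarith
  have q₁' := mul_le_mul_of_nonneg_left q₁ hcpos.le
  have q₀' := mul_le_mul_of_nonneg_left q₀ hcpos.le
  have q₂' := mul_le_mul_of_nonneg_left q₂ hcpos.le
  have hY : 0 < (f₁ - c * (u₁ ^ (n + 1)).re) ^ 2 -
      (f₀ - c * (u₁ ^ n).re) * (f₂ - c * (u₁ ^ (n + 2)).re) := by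
    have hm : c ^ 2 * (u₁ ^ (n + 1)).re ^ 2 - c ^ 2 * ((u₁ ^ n).re * (u₁ ^ (n + 2)).re) = c ^ 2 * b ^ 2 := by
      rw [← main]
      ring
    nlinarith [sq_nonneg f₁, hm, q₁', q₀', q₂', q₃, hδδ, hδ2, hcb]
  have hscale : r₀ ^ n * r₀ ^ (n + 2) * (keiperLiCoeff (n + 1) ^ 2 - keiperLiCoeff n * keiperLiCoeff (n + 2))
      = (f₁ - c * (u₁ ^ (n + 1)).re) ^ 2 - (f₀ - c * (u₁ ^ n).re) * (f₂ - c * (u₁ ^ (n + 2)).re) := by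
    rw [hf₀, hf₁, hf₂]
    ring
  have hpos := pos_of_mul_pos_right (hscale ▸ hY) (by positivity)
  linarith

/-- **γ-type splitting** `A′ ∧ TuranFail ⟹ RH` with `A′ :=` «if RH fails, the extremal layer lies in one conjugate pair» (vacuous
under RH) and `TuranFail :=` «`λ_{n+1}² < λ_nλ_{n+2}` infinitely often» (an RH-consequence, §3).  CONDITIONAL bookkeeping: neither
conjunct is proved; this is NOT a lens-(ii) bridge. -/
theorem rh_of_pairLayerAlt_of_turanFail
    (hA : ¬ _root_.RiemannHypothesis → ∃ ρ₀ : ℂ, ∀ ρ ∈ ZetaZeros.riemannZetaNontrivialZeros,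
      (∀ ρ' ∈ ZetaZeros.riemannZetaNontrivialZeros, ‖1 - 1 / ρ‖ ≤ ‖1 - 1 / ρ'‖) → ρ = ρ₀ ∨ ρ = conj ρ₀)
    (hB : ∀ N : ℕ, ∃ n : ℕ, N ≤ n ∧ keiperLiCoeff (n + 1) ^ 2 < keiperLiCoeff n * keiperLiCoeff (n + 2)) :
    _root_.RiemannHypothesis := by
  by_contra hRH
  obtain ⟨N, hN⟩ := eventually_logConcave_of_not_rh_of_pairLayer hRH (hA hRH)
  obtain ⟨n, hn, hlt⟩ := hB N
  exact absurd (hN n hn) (not_lt.2 hlt.le)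

/-- … and conversely RH gives both conjuncts (`A′` vacuously, `TuranFail` by §3): modulo `A′`, `TuranFail ⟺ RH`. -/
theorem turanFail_iff_rh_of_pairLayerAlt
    (hA : ¬ _root_.RiemannHypothesis → ∃ ρ₀ : ℂ, ∀ ρ ∈ ZetaZeros.riemannZetaNontrivialZeros,
      (∀ ρ' ∈ ZetaZeros.riemannZetaNontrivialZeros, ‖1 - 1 / ρ‖ ≤ ‖1 - 1 / ρ'‖) → ρ = ρ₀ ∨ ρ = conj ρ₀) :
    (∀ N : ℕ, ∃ n : ℕ, N ≤ n ∧ keiperLiCoeff (n + 1) ^ 2 < keiperLiCoeff n * keiperLiCoeff (n + 2)) ↔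
      _root_.RiemannHypothesis :=
  ⟨rh_of_pairLayerAlt_of_turanFail hA, turanFail_io_of_rh⟩

end Summit.RiemannHypothesis.RiemannHypothesis.Theorems.Splittings.LiTuranLaw

end
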